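import Mathlib.RingTheory.PiTensorProduct
import Mathlib.NumberTheory.NumberField.Basic
import Mathlib.Analysis.Complex.Basic
import Mathlib.Algebra.Group.Submonoid.Operations
import Mathlib.Algebra.Group.Submonoid.Units
import Mathlib.Algebra.Module.Submodule.Basic
import HarnessLib

/-!
# [IUTchIII] Propositions 3.3, 3.4: global tensor packets and local packet-theoretic
# Frobenioids / LGP-monoids (abc-iut cell, layer L6, slice [IUTchIII] §3)

S. Mochizuki, *Inter-universal Teichmüller theory III*, kurims manuscript (May 2020) of PRIMS
**57** (2021), §3: Proposition 3.3 "(Global Tensor Packets)" pp. 99–100, Remarks 3.3.1–3.3.3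
pp. 100–101, Proposition 3.4 "(Local Packet-theoretic Frobenioids)" pp. 101–103 (PRIMS offset
≈ +420). STATEMENTS-FIRST typing over INTERFACES (plan/FOUNDATIONS.md boundary column):

* Proposition 3.3: the global `n`-tensor packet `(†𝕄⊛_mod)_A := ⊗_{α∈A} (†𝕄⊛_mod)_α` is a REAL
  `PiTensorProduct` over `ℚ` of the labelled number fields `(†𝕄⊛_mod)_α` ([IUTchII] Cor. 4.8 (i),
  (ii) — TODO-merge: abc-iut-L6-t2); the homomorphism `(†𝕄⊛_mod)_α → (†𝕄⊛_mod)_A` "by forming the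
  tensor product with 1's" of (ii) is Mathlib's `PiTensorProduct.singleAlgHom`; the localization
  homomorphism of (i) (built from the localization functors of [IUTchII] Cor. 4.8 (iii) and the
  given log-links) enters as an INTERFACE datum `LocalizationHom`; the printed properties are named
  `Prop`s.
* Proposition 3.4 (i): the single packet monoids `Ψ_{log(^{A,α}𝓕_v)}`, `Ψ^×_{log(^{A,α}𝓕_v)}` are
  REAL images of submonoids along the ring homomorphism `log(^α𝓕_v) → log(^{A,α}𝓕_v)` of
  Proposition 3.1 (ii) (which enters as an abstract algebra homomorphism `ι`, so that this file does
  not depend on `TensorPackets.lean`); the realification `Ψ^ℝ` ([FrdI] — TODO-merge: abc-iut-L1)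
  and the Frobenioid / Aut-holomorphic-orbispace conclusions are recorded as docstring text only.
* Proposition 3.4 (ii): the "[local] LGP-monoids" `Ψ_{𝓕_LGP}(†𝓗𝓣)_v`, `_∞Ψ_{𝓕_LGP}(†𝓗𝓣)_v` are the
  OUTPUT of a "functorial algorithm in the log-link of Θ^{±ell}NF-Hodge theaters"; absent the Hodge
  theaters ([IUTchI] §6 — abc-iut-L5-t4) and Gaussian monoids ([IUTchII] Cor. 4.6 (iv) —
  abc-iut-L6-t2) we type the OUTPUT SIGNATURE `LGPMonoidSignature` whose Prop-valued fields quote the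
  two printed properties at `v ∈ 𝕍^bad` resp. arbitrary `v` (p. 103).
Group actions (`G_v(^αΠ_v)`, Galois invariants) are modelled only as distinguished sub-objects
("the submonoid of Galois invariants"); ind-topologies are not modelled. Tag form
[claim: Mochizuki2012, status: disputed] (D-0012 claim key).
-/

namespace Literature.IUT.LogThetaLattice

open scoped TensorProduct
open PiTensorProduct

universe u v w

/-! ### Proposition 3.3: global tensor packets -/

section GlobalPackets

variable {A : Type v} [Fintype A] [DecidableEq A]
variable (F : A → Type u) [∀ α, Field (F α)] [∀ α, Algebra ℚ (F α)]

/-- The **global [n-]tensor packet** `(†𝕄⊛_mod)_A := ⊗_{α∈A} (†𝕄⊛_mod)_α` "associated to the subset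
`A ⊆ J` and the Θ^{±ell}NF-Hodge theater `†𝓗𝓣^{Θ±ell NF}`" ([IUTchIII] Proposition 3.3, display,
pp. 99–100: "the tensor product is to be understood as a tensor product of modules"), for labelled
number fields `(†𝕄⊛_mod)_α = F α` ([IUTchII] Cor. 4.8 (i), (ii); interface), as a commutative
`ℚ`-algebra. [claim: Mochizuki2012, status: disputed] -/
abbrev GlobalPacket : Type _ := ⨂[ℚ] α : A, F α

/-- [IUTchIII] Proposition 3.3 (ii), first display, p. 100: "by forming the tensor product with 1's
in the factors labeled by `β ∈ A∖{α}`, one obtains a natural ring homomorphism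
`(†𝕄⊛_mod)_α → (†𝕄⊛_mod)_A`" — Mathlib's `PiTensorProduct.singleAlgHom`.
[claim: Mochizuki2012, status: disputed] -/
noncomputable def GlobalPacket.single (α : A) : F α →ₐ[ℚ] GlobalPacket F :=
  PiTensorProduct.singleAlgHom α

/-- [IUTchIII] Proposition 3.3 (i) "(Ring Structures)", first sentence, p. 100: "The field
structure on the various `(†𝕄⊛_mod)_α`, for `α ∈ A`, determine a ring structure on `(†𝕄⊛_mod)_A`
with respect to which `(†𝕄⊛_mod)_A` decomposes, uniquely, as a direct sum of number fields" (the
ring structure is the `PiTensorProduct` algebra structure; typed: a ring isomorphism with a finite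
product of number fields exists). [claim: Mochizuki2012, status: disputed] -/
def Prop33i_directSumOfNumberFields : Prop :=
  ∃ (ι : Type (max u v)) (_ : Fintype ι) (K : ι → Type (max u v)) (_ : ∀ i, Field (K i))
    (_ : ∀ i, NumberField (K i)), Nonempty (GlobalPacket F ≃+* ∀ i, K i)

variable {VQ : Type w} (P : VQ → Type (max u v)) [∀ vQ, CommRing (P vQ)]

/-- INTERFACE datum for [IUTchIII] Proposition 3.3 (i), second sentence, p. 100: "the various
localization functors `(†𝓕⊛_mod)_j → †𝓕_j` considered in [IUTchII], Corollary 4.8, (iii),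
determine, by composing with the given log-links, a natural injective localization ring
homomorphism `(†𝕄⊛_mod)_A → log(^A𝓕_{𝕍_ℚ}) := Π_{v_ℚ ∈ 𝕍_ℚ} log(^A𝓕_{v_ℚ})` to the product of the local
holomorphic tensor packets" (`P v_ℚ` = the ring `log(^A𝓕_{v_ℚ})` of Proposition 3.1). The
construction needs [IUTchII] Cor. 4.8 (iii) and [IUTchIII] Def. 1.1 (TODO-merge: abc-iut-L6-t2,
abc-iut-L6-t3); here its printed properties are the fields. [claim: Mochizuki2012, status: disputed] -/
structure LocalizationHom where
  /-- the localization ring homomorphism `(†𝕄⊛_mod)_A → Π_{v_ℚ} log(^A𝓕_{v_ℚ})` -/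
  toRingHom : GlobalPacket F →+* ∀ vQ, P vQ
  /-- "injective" (Proposition 3.3 (i), p. 100) -/
  injective : Function.Injective toRingHom

/-- [IUTchIII] Proposition 3.3 (ii), p. 100: the homomorphism `(†𝕄⊛_mod)_α → (†𝕄⊛_mod)_A` "induces an
isomorphism of the domain onto a subfield of each of the direct summand number fields of the
codomain" — typed: for every product-of-fields decomposition `e`, each composite
`(†𝕄⊛_mod)_α → K_i` is injective. [claim: Mochizuki2012, status: disputed] -/
def Prop33ii_ontoSubfield (α : A) : Prop :=
  ∀ (ι : Type (max u v)) (K : ι → Type (max u v)) (_ : ∀ i, Field (K i))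
    (e : GlobalPacket F ≃+* ∀ i, K i) (i : ι),
    Function.Injective fun x : F α => e (GlobalPacket.single F α x) i

/-- [IUTchIII] Proposition 3.3 (ii), nonarchimedean clause, p. 100: "for each `v_ℚ ∈ 𝕍_ℚ^non`, the
composite of the above displayed homomorphism with the component at `v_ℚ` of the localization
homomorphism of (i) maps the ring of integers of the number field `(†𝕄⊛_mod)_α` into the submodule
constituted by the integral structure on `log(^A𝓕_{v_ℚ})` considered in Proposition 3.1, (ii)"
(`OA v_ℚ` = that integral structure, `isNon` = the nonarchimedean places).
[claim: Mochizuki2012, status: disputed] -/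
def Prop33ii_integersNon [∀ α, NumberField (F α)] (loc : LocalizationHom F P)
    (isNon : VQ → Prop) (OA : ∀ vQ, Subring (P vQ)) (α : A) : Prop :=
  ∀ vQ, isNon vQ → ∀ x : NumberField.RingOfIntegers (F α),
    loc.toRingHom (GlobalPacket.single F α (x : F α)) vQ ∈ OA vQ

/-- [IUTchIII] Proposition 3.3 (ii), archimedean clause, p. 100: "for each `v_ℚ ∈ 𝕍_ℚ^arc`, the
composite … maps the set of archimedean integers [i.e., elements of absolute value `≤ 1` at all
archimedean primes] of the number field `(†𝕄⊛_mod)_α` into the direct product of subsets constituted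
by the integral structures … on the various direct summand ind-topological fields of
`log(^A𝓕_{v_ℚ})`" (`Oarc v_ℚ` = that product subset). [claim: Mochizuki2012, status: disputed] -/
def Prop33ii_integersArc (loc : LocalizationHom F P) (isArc : VQ → Prop)
    (Oarc : ∀ vQ, Set (P vQ)) (α : A) : Prop :=
  ∀ vQ, isArc vQ → ∀ x : F α, (∀ σ : F α →+* ℂ, ‖σ x‖ ≤ 1) →
    loc.toRingHom (GlobalPacket.single F α x) vQ ∈ Oarc vQ

/-- [IUTchIII] Remark 3.3.1, p. 100: "One may perform analogous constructions to the constructions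
of Proposition 3.3 for the fields `𝕄⊛_mod(†𝒟^⊚)_j` of [IUTchII], Corollary 4.7, (ii) … These
constructions are compatible with the corresponding constructions of Proposition 3.3 … relative to
the various labeled Kummer-theoretic isomorphisms of [IUTchII], Corollary 4.8, (ii)." Typed: the
étale-like global packet `⊗_α 𝕄⊛_mod(†𝒟^⊚)_α` and the packet isomorphism induced by labelled
Kummer isomorphisms `(†𝕄⊛_mod)_α ≅ 𝕄⊛_mod(†𝒟^⊚)_α` (functoriality; the Kummer isomorphisms are
interface data, [IUTchII] Cor. 4.8 (ii)). [claim: Mochizuki2012, status: disputed] -/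
noncomputable def Remark331_compat (Fet : A → Type u) [∀ α, Field (Fet α)] [∀ α, Algebra ℚ (Fet α)]
    (kum : ∀ α, F α ≃ₐ[ℚ] Fet α) : GlobalPacket F ≃ₗ[ℚ] GlobalPacket Fet :=
  PiTensorProduct.congr fun α => (kum α).toLinearEquiv

/-- [IUTchIII] Remark 3.3.2 (i), (ii), p. 101: "One may consider the image of the localization
homomorphism of Proposition 3.3, (i), in the case of the various local holomorphic tensor packets
arising from processions" ((i); for `|𝔽_l|`-processions via the identifying isomorphisms between the
labels `0` and `⟨𝔽_l^⋇⟩` of [IUTchII] Cor. 4.6 (iii)) and likewise ((ii)) the image of its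
`𝒟`-version composed with the inverses of the mono-analytic/holomorphic compatibility isomorphisms of
Proposition 3.2 (i). Typed: the image subring of a localization homomorphism (holomorphic or, after
composition with a ring isomorphism onto the mono-analytic packets, mono-analytic).
[claim: Mochizuki2012, status: disputed] -/
def Remark332_image (loc : LocalizationHom F P) : Subring (∀ vQ, P vQ) :=
  loc.toRingHom.range

/-- [IUTchIII] Remark 3.3.2 (iii), p. 101: "The various images of global tensor packets discussed
in (i) and (ii) above may be identified — i.e., in light of the injectivity of the homomorphisms
applied to construct these images — with the global tensor packets themselves": the localization
homomorphism co-restricts to a ring isomorphism onto its image. PROVED from the interface axiom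
`injective`. [claim: Mochizuki2012, status: disputed] -/
noncomputable def Remark332iii_identification (loc : LocalizationHom F P) :
    GlobalPacket F ≃+* Remark332_image F P loc :=
  RingEquiv.ofBijective loc.toRingHom.rangeRestrict
    ⟨fun _ _ h => loc.injective (Subtype.ext_iff.mp h),
      loc.toRingHom.rangeRestrict_surjective⟩

/-- [IUTchIII] Remark 3.3.3, p. 101: "The log-shifted nature of the localization homomorphism of
Proposition 3.3, (i), will play a crucial role … cf. [IUTchII], Remark 4.8.2, (i), (iii)" — i.e.
the localization homomorphism lands in the packets built from the CODOMAINS `†𝓕_α` of the given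
log-links `^α𝓕 →^{log} †𝓕_α` (Proposition 3.3, hypothesis, p. 99). Typed as the datum recording, for
a localization homomorphism, the log-links it was composed with (interface type `LogLink`).
[claim: Mochizuki2012, status: disputed] -/
structure Remark333_logShiftDatum (LogLink : A → Type w) where
  /-- the localization homomorphism of Proposition 3.3 (i) -/
  loc : LocalizationHom F P
  /-- the log-links `^α𝓕 →^{log} †𝓕_α`, `α ∈ A`, through which `loc` factors -/
  logLinks : ∀ α, LogLink α

end GlobalPackets

/-! ### Proposition 3.4 (i): single packet monoids -/

section SinglePacketMonoids

variable {𝕜 : Type u} [Field 𝕜] {Lv : Type v} [CommRing Lv] [Algebra 𝕜 Lv]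
variable {Pv : Type w} [CommRing Pv] [Algebra 𝕜 Pv]

/-- [IUTchIII] Proposition 3.4 (i) "(Single Packet Monoids)", pp. 101–102: "the operation of
forming the image via the natural homomorphism `log(^α𝓕_v) → log(^{A,α}𝓕_v)` [cf. Proposition 3.1,
(ii)] of the monoid `Ψ_{log(^α𝓕_v)}` … determines [a monoid] `Ψ_{log(^{A,α}𝓕_v)}`" — the image
submonoid along `ι = toPacketAt` (abstract here). [claim: Mochizuki2012, status: disputed] -/
def singlePacketMonoid (ι : Lv →ₐ[𝕜] Pv) (Ψ : Submonoid Lv) : Submonoid Pv :=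
  Ψ.map (ι : Lv →* Pv)

/-- [IUTchIII] Proposition 3.4 (i), p. 102: "… together with its submonoid of units
`Ψ^×_{log(^α𝓕_v)}` … determines … `Ψ^×_{log(^{A,α}𝓕_v)}`" — the image of the unit group of `Ψ`
(elements of `Ψ` invertible inside `Ψ`). The realification `Ψ^ℝ_{log(^{A,α}𝓕_v)}` needs the
realification functor of [FrdI] (TODO-merge: abc-iut-L1, `Frobenioids/Monoids.lean` deliberately
omits `M ⊗ ℝ_{≥0}`) and is not typed here. [claim: Mochizuki2012, status: disputed] -/
def singlePacketUnits (ι : Lv →ₐ[𝕜] Pv) (Ψ : Submonoid Lv) : Submonoid Pv :=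
  (IsUnit.submonoid Ψ).map ((ι : Lv →* Pv).comp Ψ.subtype)

omit [Algebra 𝕜 Lv] [Algebra 𝕜 Pv] in
/-- Images of units of `Ψ` are units of the image monoid (Proposition 3.4 (i), p. 102: `Ψ^×` is "its
submonoid of units"). [claim: Mochizuki2012, status: disputed] -/
theorem singlePacketUnits_le [Algebra 𝕜 Lv] [Algebra 𝕜 Pv] (ι : Lv →ₐ[𝕜] Pv) (Ψ : Submonoid Lv) :
    singlePacketUnits ι Ψ ≤ singlePacketMonoid ι Ψ := by
  rintro _ ⟨u, -, rfl⟩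
  exact ⟨u, u.2, rfl⟩

/-- [IUTchIII] Proposition 3.4 (i), p. 102: "We shall think of these monoids as [possibly
realified] subquotients of `log(^{A,α}𝓕_v)` that act [multiplicatively] on suitable [possibly
realified] subquotients of `log(^{A,α}𝓕_v)`. In particular, when `v ∈ 𝕍^non`, the first displayed
monoid, together with its `^αΠ_v`-action, determine[s] a Frobenioid equipped with a natural
isomorphism to `log(^α𝓕_v)`; when `v ∈ 𝕍^arc`, … an Aut-holomorphic orbispace and Kummer structure
…". Typed (action clause only): the image monoid acts by multiplication on `log(^{A,α}𝓕_v)` and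
preserves any sub-`𝕜`-module stable under `Ψ` — here the tautological statement that a submodule
closed under multiplication by `ι(Ψ)` is preserved. The Frobenioid / Aut-holomorphic clauses need
[FrdI] Def. 1.3 and [AbsTopIII] §2 (TODO-merge: abc-iut-L1, abc-iut-L4-t2).
[claim: Mochizuki2012, status: disputed] -/
def Prop34i_actsOn (ι : Lv →ₐ[𝕜] Pv) (Ψ : Submonoid Lv) (M : Submodule 𝕜 Pv) : Prop :=
  ∀ x ∈ singlePacketMonoid ι Ψ, ∀ m ∈ M, x * m ∈ M

end SinglePacketMonoids

/-! ### Proposition 3.4 (ii): local logarithmic Gaussian procession monoids (output signature) -/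

section LGPMonoids

variable (lstar : ℕ) (V : Type v) (isBad : V → Prop)

/-- OUTPUT SIGNATURE of [IUTchIII] Proposition 3.4 (ii) "(Local Logarithmic Gaussian Procession
Monoids)", pp. 102–103: "a functorial algorithm in the log-link of Θ^{±ell}NF-Hodge theaters
`‡𝓗𝓣 →^{log} †𝓗𝓣` for constructing [collections of] monoids equipped with actions by topological
groups when `v ∈ 𝕍^non` and splittings [up to torsion, when `v ∈ 𝕍^bad`]
`𝕍 ∋ v ↦ Ψ_{𝓕_LGP}(†𝓗𝓣)_v`; `𝕍 ∋ v ↦ _∞Ψ_{𝓕_LGP}(†𝓗𝓣)_v` — which we refer to as [local] LGP-monoids",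
obtained by applying (i) to the label `j ∈ {1, …, l^⋇}` of the `(j+1)`-capsule of the holomorphic
`‡`-procession and pulling back the Gaussian monoids `Ψ_{𝓕_gau}(†𝓗𝓣^Θ)_v`, `_∞Ψ_{𝓕_gau}(†𝓗𝓣^Θ)_v` of
[IUTchII] Cor. 4.6 (iv) (cf. Fig. 3.1, p. 101: the splitting monoid at label `j` is generated by
`q^{j²}`). The ambient ring `R v j` stands for `log(^{S^±_{j+1}, j; ‡}𝓕_v)`, `IQ v j` for
`𝓘^ℚ(^{S^±_{j+1}, j; ‡}𝓕_v)` (Proposition 3.2 (ii)); Galois actions are modelled by the distinguished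
submonoids of invariants. Inputs not yet in the tree: Θ^{±ell}NF-Hodge theaters ([IUTchI] Def. 6.13
— abc-iut-L5-t4), Gaussian monoids ([IUTchII] Cor. 4.6 — abc-iut-L6-t2), log-links ([IUTchIII]
Def. 1.1 — abc-iut-L6-t3). [claim: Mochizuki2012, status: disputed] -/
structure LGPMonoidSignature (R : V → Fin lstar → Type u) [∀ v j, CommRing (R v j)]
    [∀ v j, Algebra ℚ (R v j)] (IQ : ∀ v j, Submodule ℚ (R v j)) where
  /-- `Ψ_{𝓕_LGP}(†𝓗𝓣)_v`, component labelled `j` -/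
  Ψ : ∀ v j, Submonoid (R v j)
  /-- `_∞Ψ_{𝓕_LGP}(†𝓗𝓣)_v`, component labelled `j` -/
  ΨInf : ∀ v j, Submonoid (R v j)
  /-- the submonoid of Galois invariants of `Ψ` (all of `Ψ` at archimedean `v`, where "this Galois
  action is trivial", p. 103) -/
  ΨGal : ∀ v j, Submonoid (R v j)
  /-- Galois invariants lie in `Ψ` -/
  gal_le : ∀ v j, ΨGal v j ≤ Ψ v j
  /-- the unit portion `Ψ_{𝓕_LGP}(†𝓗𝓣)^×_v` (Galois-invariant part), component `j` -/
  ΨUnitsGal : ∀ v j, Submonoid (R v j)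
  /-- units are elements of the invariant monoid -/
  unitsGal_le : ∀ v j, ΨUnitsGal v j ≤ ΨGal v j
  /-- for `v ∈ 𝕍^bad`: the splitting up to torsion, `Ψ^⊥_{𝓕_LGP}(†𝓗𝓣)_v ⊆ Ψ_{𝓕_LGP}(†𝓗𝓣)_v`
  (notation of Proposition 3.5 (ii) (c), p. 105) -/
  ΨSplit : ∀ v, isBad v → ∀ j, Submonoid (R v j)
  /-- the splitting monoid is a submonoid of `Ψ` -/
  split_le : ∀ v (h : isBad v) j, ΨSplit v h j ≤ Ψ v j
  /-- p. 103, first property: "For `v ∈ 𝕍^bad`, the component labeled `j` … of the submonoid of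
  Galois invariants … of the entire LGP-monoid `Ψ_{𝓕_LGP}(†𝓗𝓣)_v` is a subset of
  `𝓘^ℚ(^{S^±_{j+1},j;‡}𝓕_v)` … that acts multiplicatively on `𝓘^ℚ(^{S^±_{j+1},j;‡}𝓕_v)`" -/
  bad_gal_subset : ∀ v, isBad v → ∀ j, (ΨGal v j : Set (R v j)) ⊆ IQ v j
  /-- (continued) "… acts multiplicatively on `𝓘^ℚ(…)`" -/
  bad_gal_acts : ∀ v, isBad v → ∀ j, ∀ x ∈ ΨGal v j, ∀ m ∈ IQ v j, x * m ∈ IQ v j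
  /-- p. 103, second property: "For any `v ∈ 𝕍`, the component labeled `j` … of the submodule of
  Galois invariants … of the unit portion `Ψ_{𝓕_LGP}(†𝓗𝓣)^×_v` … is a subset of
  `𝓘^ℚ(^{S^±_{j+1},j;‡}𝓕_v)` … that acts multiplicatively on `𝓘^ℚ(^{S^±_{j+1},j;‡}𝓕_v)`" -/
  unitsGal_subset : ∀ v j, (ΨUnitsGal v j : Set (R v j)) ⊆ IQ v j
  /-- (continued) "… acts multiplicatively on `𝓘^ℚ(…)`" -/
  unitsGal_acts : ∀ v j, ∀ x ∈ ΨUnitsGal v j, ∀ m ∈ IQ v j, x * m ∈ IQ v j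

variable {lstar V isBad}
variable {R : V → Fin lstar → Type u} [∀ v j, CommRing (R v j)] [∀ v j, Algebra ℚ (R v j)]
variable {IQ : ∀ v j, Submodule ℚ (R v j)}

/-- Consequence recorded for Corollary 3.12's volume computations: at a bad place the
Galois-invariant LGP-monoid stabilises the log-shell `𝓘^ℚ` (restatement of the field
`bad_gal_acts` as closure of `𝓘^ℚ` under the action; Proposition 3.4 (ii), p. 103).
[claim: Mochizuki2012, status: disputed] -/
theorem LGPMonoidSignature.smul_mem_IQ (S : LGPMonoidSignature lstar V isBad R IQ) {v : V}
    (hv : isBad v) (j : Fin lstar) {x m : R v j} (hx : x ∈ S.ΨGal v j) (hm : m ∈ IQ v j) :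
    x * m ∈ IQ v j :=
  S.bad_gal_acts v hv j x hx m hm

end LGPMonoids

/-! ### Proposition 3.3 (i) — statement WITH the number-field binder (appended; RQ7 finding L6-F2) -/

section NumberFieldsCorrected

variable {A : Type v} [Fintype A] [DecidableEq A]
variable (F : A → Type u) [∀ α, Field (F α)] [∀ α, NumberField (F α)] [∀ α, Algebra ℚ (F α)]

/-- [IUTchIII] Proposition 3.3 (i), first sentence, p. 100 ("`(†𝕄⊛_mod)_A` decomposes, uniquely, as a
direct sum of number fields"), with the binder `[NumberField (F α)]` that the intended instance
(`F α = ` a labelled copy of `F_mod`) satisfies (RQ7 audit finding L6-F2, abc-iut-L6-t20, INBOX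
2026-08-25T19:28:31Z: the earlier `Prop33i_directSumOfNumberFields` is a SCHEMA over arbitrary fields of
characteristic `0` and is false at junk parameters such as `F α = ℝ`; it must not be used as a discharge
target). TRUE and dischargeable by the étale-algebra route (a finite tensor product over `ℚ` of number
fields is a finite étale `ℚ`-algebra, hence a finite product of number fields).
[claim: Mochizuki2012, status: disputed] -/
def Prop33i_directSumOfNumberFields' : Prop :=
  ∃ (ι : Type (max u v)) (_ : Fintype ι) (K : ι → Type (max u v)) (_ : ∀ i, Field (K i))
    (_ : ∀ i, NumberField (K i)), Nonempty (GlobalPacket F ≃+* ∀ i, K i)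

end NumberFieldsCorrected

/-! ### Proposition 3.3 (i) — statement with the binders IN THE HEADER (appended; G-BINDER-DROP) -/

section NumberFieldsHeaderBinders

/-- [IUTchIII] Proposition 3.3 (i), first sentence, p. 100 — the number-field statement with ALL its
hypotheses written IN THE DEFINITION HEADER (finding G-BINDER-DROP, abc-iut-L6-t5, INBOX
2026-08-25T20:14:50Z: in `Prop33i_directSumOfNumberFields'` the section-`variable` instance
`[∀ α, NumberField (F α)]` is not referenced by the body and was therefore DROPPED by Lean's
section-variable rule — kernel witness `BinderDropWitness33.lean`: the primed def elaborates at
`F := fun _ => ℝ`; so `'` has the same signature as the unprimed schema and is likewise a recorded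
mis-typing, not a discharge target). Here `[Fintype A]` and `[∀ α, NumberField (F α)]` are header
binders, hence part of the constant's type (`#check @Prop33i_directSumOfNumberFields''`). TRUE and
dischargeable; abc-iut-L6-t5's `Prop33i_directSumOfNumberFields_of_numberField` (p405908) is the proof
to cite. [claim: Mochizuki2012, status: disputed] -/
def Prop33i_directSumOfNumberFields'' {A : Type v} [Fintype A] (F : A → Type u) [∀ α, Field (F α)]
    [∀ α, NumberField (F α)] [∀ α, Algebra ℚ (F α)] : Prop :=
  ∃ (ι : Type (max u v)) (_ : Fintype ι) (K : ι → Type (max u v)) (_ : ∀ i, Field (K i))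
    (_ : ∀ i, NumberField (K i)), Nonempty (GlobalPacket F ≃+* ∀ i, K i)

/-- Sanity check that the binders are now part of the statement: `''` unfolds to `'` (same body), so a
proof of the classical lemma for `'` under the number-field hypotheses proves `''` — PROVED (the point of
`''` is only that it cannot be INSTANTIATED without the hypotheses). [claim: Mochizuki2012, status: disputed] -/
theorem Prop33i_directSumOfNumberFields''_iff {A : Type v} [Fintype A] [DecidableEq A] (F : A → Type u)
    [∀ α, Field (F α)] [∀ α, NumberField (F α)] [∀ α, Algebra ℚ (F α)] :
    Prop33i_directSumOfNumberFields'' F ↔ Prop33i_directSumOfNumberFields' F :=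
  Iff.rfl

end NumberFieldsHeaderBinders

end Literature.IUT.LogThetaLattice
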